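import Summits.Ventures.HSemireg.WedgeKunnethKernelLow
import Summits.Ventures.HSemireg.WedgeHankelFaces

/-!
# Venture HSemireg — THE KERNEL OF A PURE CLASS IS THE IDEAL OF ITS FRAME: `Kr(univ, w_m(Aλ^j), k) = Σ_a (x_a + λ y_a) ∧ ⋀^{k−1}`,
# `w_m(Aλ^j) = A · Π_a (x_a + λ y_a)` — the Hankel-rank-1 («pure», line-bundle) face of the one-factor kernel dictionary, every degree

HONEST FRAMING. Part of the Lean index of the computation cell `pub-hsemireg` (seat p10 gen 13, Sunday typer «UNIFORM-IN-n»).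
Finite-dimensional EXTERIOR ALGEBRA over a field and ranks of HANKEL MATRICES ONLY: no variety, no cohomology theory, no sheaf, no Ext
group and no semiregularity map is constructed here; nothing here says that HC / HC_CM / HC_AV holds; no Literature fact is declared or
used.  Custodian versions cited: theory/FORMULA-N.md PART A §2.6 THEOREM H and its KRONECKER DICTIONARY («ρ = 1 pure (line bundle / 𝒪 /
pt)»), FN-4 (i); PART B §N.8 (th-7's recursion `w₀(q) = q₀·1`, `w_{j+1}(q) = w_j(q)·x_j + w_j(σq)·y_j`); STRUCTURE.md v1.0-SIGNED
9b196a05977dd067 §1.1 C15.  The dictionary (`A·exp(λΘ) = Σ_j Aλ^j Θ^j/j!` ↦ `w_m(Aλ^j)`; `⌟v` on `HT^k` ↦ `θ ↦ θ ∧ w_m(q)` on `⋀^k K^{2m}`)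
is QUOTED, never asserted.

WHAT IS KEYED.  `WedgeHankelFaces` (591): the PURE class `A·Σ_j λ^j E_j` has Hankel rank `1` (`rank_hankel1_expSeq`), rank `C(m,k)` on `⋀^k`
(`finrank_range_wedge_w_expSeq`) — the NUMBER of its kernel, `C(2m,k) − C(m,k)`, not its NAME; `WedgeKunnethKernel{,Low}` (C1/C2): the factor
kernel spaces `Kr(D, f, a)` and the Künneth kernel law.  With gen 11's Siegel ideals (full Hankel rank) and gen 13 C3 (non-pure classes) the
one missing face of the one-factor kernel dictionary is the PURE one; THIS FILE names it:
* §1 `w` is linear in the coefficients (`w_smul'`); **`w_expSeq`: `w_j(Aλ^•) = A · u₀ ∧ ⋯ ∧ u_{j−1}`**, FRAME VECTORS `u_a := x_a + λ y_a`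
  (`uvec`, `uprod`).
* §2 generic: the automorphism `Ψ e` of `⋀(K^I)` induced by a linear automorphism `e` of the generators (th-7's `WedgePairShear.Ψ` for any
  generator type), `Ψ e(⋀^k) = ⋀^k`, and TRANSPORT **`map_Ψ_Kr`: `Ψ e (Kr(univ, f, k)) = Kr(univ, Ψ e f, k)`**; `Kr(D, c·f, a) = Kr(D, f, a)`.
* §3 the SHEAR `e_λ : e_{x_a} ↦ e_{x_a} + λ e_{y_a}, e_{y_a} ↦ e_{y_a}` (`nilp`, `shearEquiv`): `Ψ(x_a) = u_a`,
  **`Ψ (x₀ ∧ ⋯ ∧ x_{j−1}) = u₀ ∧ ⋯ ∧ u_{j−1}`**, so `w_m(Aλ^•) = A · Ψ_λ(x₀ ∧ ⋯ ∧ x_{m−1})`.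
* §4 **`Kr_xprod`: `Kr(univ, x₀ ∧ ⋯ ∧ x_{m−1}, k)` = the span of the degree-`k` monomials MEETING the `x`-block** (`xIdeal`; th-7's
  `eq_zero_of_mul_B_eq_zero` + the support projectors of `WedgeWeilSpan`) **= `Σ_a x_a ∧ Hom(univ, k−1)`** for `k ≥ 1` (`xIdeal_eq_frameIdeal`).
* §5 **THE PURE KERNEL, NAMED — `Kr_w_expSeq`: `Kr(univ, w_m(Aλ^•), k) = Σ_{a<m} (x_a + λ y_a) ∧ Hom(univ, k−1)`** (`A ≠ 0`, every `λ`,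
  `k ≥ 1`; degree `0`: `Kr = 0`), of **dimension `C(2m,k) − C(m,k)`** (`finrank_Kr_w_expSeq_add`, `finrank_frameIdeal_uvec`); every frame vector
  kills the class (`uvec_mem_Kr_one`) — the degenerate face C3's «non-pure» hypothesis excludes; with C1/C4 boxes with pure (line-bundle)
  factors now have named kernels too.
NOT typed here: the converse (a class killed by a `1`-form is pure or zero); anything Ext-side.  Class side only.
Namespace `Summit.Ventures.HSemireg.Wedge.HankelPureKernel` (new); new names only.
-/

open Module

namespace Summit.Ventures.HSemireg.Wedge.HankelPureKernel

open Summit.Ventures.HSemireg.Wedge Summit.Ventures.HSemireg.Wedge.Kunneth Summit.Ventures.HSemireg.Wedge.KunnethKernel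
  Summit.Ventures.HSemireg.Wedge.HankelFaces

variable (K : Type*) [Field K]

/-! ## §1. Linearity of `w` and the closed form of the pure class -/

section Pure

variable {m : ℕ}

/-- th-7's Hankel class is linear in its coefficient sequence (scalars). -/
lemma w_smul' (c : K) : ∀ (j : ℕ) (q : ℕ → K), Hankel.w K m j (c • q) = c • Hankel.w K m j q
  | 0, q => by rw [Hankel.w, Hankel.w, Pi.smul_apply, smul_eq_mul, mul_smul]
  | j + 1, q => by
    rw [Hankel.w, Hankel.w, show Hankel.shift K (c • q) = c • Hankel.shift K q from rfl, w_smul' c j, w_smul' c j, smul_mul_assoc,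
      smul_mul_assoc, smul_add]

/-- the FRAME VECTOR `u_a := x_a + λ y_a` of the pure class of slope `λ` (`0` for `a ≥ m`). -/
noncomputable def uvec (m : ℕ) (lam : K) (a : ℕ) : HT K (Hankel.In m) := Hankel.X K m a + lam • Hankel.Y K m a

/-- the ordered frame product `u₀ ∧ ⋯ ∧ u_{j−1}` (`1` for `j = 0`). -/
noncomputable def uprod (m : ℕ) (lam : K) : ℕ → HT K (Hankel.In m)
  | 0 => 1
  | j + 1 => uprod m lam j * uvec K m lam j

/-- `σ(Aλ^•) = λ · (Aλ^•)`. -/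
lemma shift_expSeq (A lam : K) : Hankel.shift K (expSeq K A lam) = lam • expSeq K A lam := by
  funext j
  simp only [Hankel.shift_apply, expSeq_apply, Pi.smul_apply, smul_eq_mul, pow_succ]
  ring

/-- **THE PURE CLASS IS DECOMPOSABLE: `w_j(Aλ^•) = A · u₀ ∧ ⋯ ∧ u_{j−1}`** for every `j` (th-7's recursion with `σq = λq`). -/
theorem w_expSeq (A lam : K) : ∀ j, Hankel.w K m j (expSeq K A lam) = A • uprod K m lam j
  | 0 => by rw [Hankel.w, uprod, expSeq_apply, pow_zero, mul_one]
  | j + 1 => by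
    rw [Hankel.w, shift_expSeq, w_smul', w_expSeq A lam j, uprod, uvec, mul_add, smul_mul_assoc, smul_mul_assoc, smul_mul_assoc,
      mul_smul_comm, smul_add, smul_comm lam A]

end Pure

/-! ## §2. The automorphism of `⋀(K^I)` induced by a linear automorphism of the generators; transport of kernel spaces -/

section Generic

variable {I : Type*}

/-- a linear automorphism of the generators as an isometry of the zero form. -/
noncomputable def isoOf (e : (I → K) ≃ₗ[K] (I → K)) : (0 : QuadraticForm K (I → K)).IsometryEquiv (0 : QuadraticForm K (I → K)) :=
  { e with map_app' := fun v => by simp }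

/-- the induced algebra automorphism `Ψ e` of the exterior algebra (th-7's `WedgePairShear.Ψ`, for any generator type). -/
noncomputable def Ψ (e : (I → K) ≃ₗ[K] (I → K)) : HT K I ≃ₐ[K] HT K I := CliffordAlgebra.equivOfIsometry (isoOf K e)

variable (e : (I → K) ≃ₗ[K] (I → K))

/-- `Ψ e` on generators is `e`. -/
lemma Ψ_ι (v : I → K) : Ψ K e (ExteriorAlgebra.ι K v) = ExteriorAlgebra.ι K (e v) := by
  rw [Ψ, CliffordAlgebra.equivOfIsometry_apply]
  show CliffordAlgebra.map _ (CliffordAlgebra.ι _ v) = CliffordAlgebra.ι _ _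
  rw [CliffordAlgebra.map_apply_ι]
  rfl

/-- `Ψ e` maps the generators onto the generators. -/
lemma map_Ψ_range_ι :
    Submodule.map (Ψ K e).toLinearMap (LinearMap.range (ExteriorAlgebra.ι K : (I → K) →ₗ[K] HT K I)) =
      LinearMap.range (ExteriorAlgebra.ι K : (I → K) →ₗ[K] HT K I) := by
  rw [← LinearMap.range_comp]
  have h : (Ψ K e).toLinearMap ∘ₗ (ExteriorAlgebra.ι K : (I → K) →ₗ[K] HT K I) =
      (ExteriorAlgebra.ι K : (I → K) →ₗ[K] HT K I) ∘ₗ e.toLinearMap := by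
    refine LinearMap.ext fun v => ?_
    simp only [LinearMap.coe_comp, Function.comp_apply, LinearEquiv.coe_coe]
    exact Ψ_ι K e v
  rw [h, LinearMap.range_comp_of_range_eq_top _ (LinearEquiv.range e)]

/-- `Ψ e` maps `⋀^k` onto `⋀^k`. -/
lemma map_Ψ_exteriorPower (k : ℕ) :
    Submodule.map (Ψ K e).toLinearMap (⋀[K]^k (I → K)) = ⋀[K]^k (I → K) := by
  show Submodule.map (Ψ K e).toAlgHom.toLinearMap (LinearMap.range (ExteriorAlgebra.ι K) ^ k) = LinearMap.range (ExteriorAlgebra.ι K) ^ k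
  rw [Submodule.map_pow, show (Ψ K e).toAlgHom.toLinearMap = (Ψ K e).toLinearMap from rfl, map_Ψ_range_ι]

variable [LinearOrder I] [Fintype I]

/-- `Ψ e` preserves `Hom(univ, k)`. -/
lemma map_Ψ_Hom_univ (k : ℕ) :
    Submodule.map (Ψ K e).toLinearMap (Hom K I Finset.univ k) = Hom K I Finset.univ k := by
  rw [Hom_univ_eq_exteriorPower, map_Ψ_exteriorPower]

/-- **KERNEL SPACES TRANSPORT: `Ψ e (Kr(univ, f, k)) = Kr(univ, Ψ e f, k)`.** -/
theorem map_Ψ_Kr (f : HT K I) (k : ℕ) :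
    (Kr K Finset.univ f k).map (Ψ K e).toLinearMap = Kr K Finset.univ (Ψ K e f) k := by
  apply le_antisymm
  · rintro _ ⟨θ, hθ, rfl⟩
    obtain ⟨hθH, hθf⟩ := mem_Kr.mp hθ
    refine mem_Kr.mpr ⟨?_, ?_⟩
    · rw [← map_Ψ_Hom_univ K e k]; exact ⟨θ, hθH, rfl⟩
    · rw [AlgEquiv.toLinearMap_apply, ← map_mul, hθf, map_zero]
  · intro θ' hθ'
    obtain ⟨hθ'H, hθ'f⟩ := mem_Kr.mp hθ'
    rw [← map_Ψ_Hom_univ K e k] at hθ'H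
    obtain ⟨θ, hθ, rfl⟩ := hθ'H
    refine ⟨θ, mem_Kr.mpr ⟨hθ, (Ψ K e).injective ?_⟩, rfl⟩
    rw [map_mul, map_zero]
    exact hθ'f

/-- a non-zero scalar does not change the kernel spaces: `Kr(D, c·f, a) = Kr(D, f, a)`. -/
lemma Kr_smul (D : Finset I) {c : K} (hc : c ≠ 0) (f : HT K I) (a : ℕ) : Kr K D (c • f) a = Kr K D f a := by
  ext θ
  rw [mem_Kr, mem_Kr, mul_smul_comm, smul_eq_zero, or_iff_right hc]

end Generic

/-! ## §3. The shear of th-7's model: `x_a ↦ x_a + λ y_a`, `y_a ↦ y_a` -/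

section Shear

variable (m : ℕ)

/-- the square-zero map `e_{x_a} ↦ e_{y_a}`, `e_{y_a} ↦ 0` on the generators `Fin (m+m)`. -/
noncomputable def nilp : (Hankel.In m → K) →ₗ[K] (Hankel.In m → K) :=
  (b K (Hankel.In m)).constr K fun i => if h : (i : ℕ) < m then b K (Hankel.In m) (Hankel.yI (i : ℕ) h) else 0

/-- `nilp` on an `x`-generator. -/
lemma nilp_b_xI {a : ℕ} (ha : a < m) : nilp K m (b K (Hankel.In m) (Hankel.xI a ha)) = b K (Hankel.In m) (Hankel.yI a ha) := by
  rw [nilp, Basis.constr_basis, dif_pos (show ((Hankel.xI a ha : Hankel.In m) : ℕ) < m from ha)]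
  rfl

/-- `nilp` kills the `y`-generators. -/
lemma nilp_b_yI {a : ℕ} (ha : a < m) : nilp K m (b K (Hankel.In m) (Hankel.yI a ha)) = 0 := by
  rw [nilp, Basis.constr_basis, dif_neg]
  show ¬ ((Hankel.yI a ha : Hankel.In m) : ℕ) < m
  simp [Hankel.yI]

/-- `nilp ∘ nilp = 0`. -/
lemma nilp_comp_nilp : nilp K m ∘ₗ nilp K m = 0 := by
  refine (b K (Hankel.In m)).ext fun i => ?_
  rw [LinearMap.comp_apply, LinearMap.zero_apply]
  by_cases h : (i : ℕ) < m
  · have hi : i = Hankel.xI (i : ℕ) h := Fin.ext rfl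
    rw [hi, nilp_b_xI, nilp_b_yI]
  · rw [nilp, Basis.constr_basis, dif_neg h, map_zero]

/-- **the SHEAR `e_λ := id + λ·nilp`** (inverse `id − λ·nilp`): `e_{x_a} ↦ e_{x_a} + λ e_{y_a}`, `e_{y_a} ↦ e_{y_a}`. -/
noncomputable def shearEquiv (lam : K) : (Hankel.In m → K) ≃ₗ[K] (Hankel.In m → K) :=
  LinearEquiv.ofLinear (LinearMap.id + lam • nilp K m) (LinearMap.id - lam • nilp K m)
    (by
      refine LinearMap.ext fun v => ?_
      have h := LinearMap.congr_fun (nilp_comp_nilp K m) v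
      rw [LinearMap.comp_apply, LinearMap.zero_apply] at h
      simp only [LinearMap.comp_apply, LinearMap.add_apply, LinearMap.sub_apply, LinearMap.id_apply, LinearMap.smul_apply,
        map_sub, map_smul, h, smul_zero]
      abel)
    (by
      refine LinearMap.ext fun v => ?_
      have h := LinearMap.congr_fun (nilp_comp_nilp K m) v
      rw [LinearMap.comp_apply, LinearMap.zero_apply] at h
      simp only [LinearMap.comp_apply, LinearMap.add_apply, LinearMap.sub_apply, LinearMap.id_apply, LinearMap.smul_apply,
        map_add, map_smul, h, smul_zero]
      abel)

/-- the shear on a generator vector. -/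
lemma shearEquiv_apply (lam : K) (v : Hankel.In m → K) : shearEquiv K m lam v = v + lam • nilp K m v := rfl

/-- **`Ψ_λ(x_a) = u_a = x_a + λ y_a`.** -/
theorem Ψ_shear_X (lam : K) (a : ℕ) : Ψ K (shearEquiv K m lam) (Hankel.X K m a) = uvec K m lam a := by
  by_cases ha : a < m
  · rw [uvec, Hankel.X, Hankel.Y, dif_pos ha, dif_pos ha, Hankel.gx_eq_ι, Hankel.gx_eq_ι, Ψ_ι, shearEquiv_apply, nilp_b_xI,
      map_add, map_smul]
  · rw [uvec, Hankel.X, Hankel.Y, dif_neg ha, dif_neg ha, map_zero, smul_zero, add_zero]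

/-- the ordered `x`-product `x₀ ∧ ⋯ ∧ x_{j−1}` (= the frame product of slope `0`). -/
noncomputable def xprod (j : ℕ) : HT K (Hankel.In m) := uprod K m 0 j

/-- `xprod (j+1) = xprod j ∧ x_j`. -/
lemma xprod_succ (j : ℕ) : xprod K m (j + 1) = xprod K m j * Hankel.X K m j := by rw [xprod, uprod, uvec, zero_smul, add_zero]; rfl

/-- **`Ψ_λ (x₀ ∧ ⋯ ∧ x_{j−1}) = u₀ ∧ ⋯ ∧ u_{j−1}`.** -/
theorem Ψ_shear_xprod (lam : K) : ∀ j, Ψ K (shearEquiv K m lam) (xprod K m j) = uprod K m lam j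
  | 0 => by rw [xprod, uprod, uprod, map_one]
  | j + 1 => by rw [xprod_succ, map_mul, Ψ_shear_xprod lam j, Ψ_shear_X, uprod]

/-- hence **the pure class is the shear of the point class: `w_m(Aλ^•) = A · Ψ_λ(x₀ ∧ ⋯ ∧ x_{m−1})`**. -/
theorem w_expSeq_eq_Ψ (A lam : K) (j : ℕ) : Hankel.w K m j (expSeq K A lam) = A • Ψ K (shearEquiv K m lam) (xprod K m j) := by
  rw [w_expSeq, Ψ_shear_xprod]

/-! ## §4. The kernel of the `x`-monomial -/

/-- the `x`-block of the first `j` indices, as a set of generators. -/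
def xblk (j : ℕ) : Finset (Hankel.In m) := Finset.univ.filter fun i => (i : ℕ) < j

/-- `x_j ∉ xblk j`. -/
lemma xI_notMem_xblk {j : ℕ} (hj : j < m) : Hankel.xI j hj ∉ xblk m j := by simp [xblk, Hankel.xI]

/-- `xblk (j+1) = xblk j ∪ {x_j}` (`j < m`). -/
lemma xblk_succ {j : ℕ} (hj : j < m) : xblk m (j + 1) = xblk m j ∪ {Hankel.xI j hj} := by
  ext i
  simp only [xblk, Finset.mem_filter, Finset.mem_univ, true_and, Finset.mem_union, Finset.mem_singleton, Fin.ext_iff, Hankel.xI]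
  omega

/-- **the `x`-product is a unit multiple of the `x`-block monomial: `x₀ ∧ ⋯ ∧ x_{j−1} = c · E_{xblk j}`, `c ≠ 0`** (`j ≤ m`). -/
theorem xprod_eq_smul_B : ∀ {j : ℕ}, j ≤ m → ∃ c : K, c ≠ 0 ∧ xprod K m j = c • B K (Hankel.In m) (xblk m j)
  | 0, _ => ⟨1, one_ne_zero, by
      rw [xprod, uprod, one_smul, show xblk m 0 = ∅ by ext i; simp [xblk], Hankel.B_empty]⟩
  | j + 1, hj => by
    have hj' : j < m := by omega
    obtain ⟨c, hc, h⟩ := xprod_eq_smul_B hj'.le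
    have hdis : Disjoint (xblk m j) {Hankel.xI j hj'} := Finset.disjoint_singleton_right.mpr (xI_notMem_xblk m hj')
    refine ⟨c * u K (xblk m j) {Hankel.xI j hj'}, mul_ne_zero hc ((u_ne_zero_iff K).mpr hdis), ?_⟩
    rw [xprod_succ, h, Hankel.X, dif_pos hj', gx, smul_mul_assoc, B_mul_B, smul_smul, xblk_succ m hj']

/-- the degree-`k` monomials MEETING the `x`-block: `xIdeal k := span{E_s : |s| = k, s ∩ x-block ≠ ∅}`. -/
noncomputable def xIdeal (k : ℕ) : Submodule K (HT K (Hankel.In m)) :=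
  Weil.Sp K fun s : Finset (Hankel.In m) => s.card = k ∧ ∃ i ∈ s, (i : ℕ) < m

/-- a monomial meeting the `x`-block kills the `x`-block monomial. -/
lemma B_mul_B_xblk_eq_zero {s : Finset (Hankel.In m)} (hs : ∃ i ∈ s, (i : ℕ) < m) : B K (Hankel.In m) s * B K (Hankel.In m) (xblk m m) = 0 := by
  obtain ⟨i, hi, him⟩ := hs
  rw [B_mul_B, u_eq_zero K, zero_smul]
  rw [Finset.not_disjoint_iff]
  exact ⟨i, hi, by simp [xblk, him]⟩

/-- the `y`-supported monomials form `Alg` of the `y`-block, which is disjoint from the `x`-block. -/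
lemma disjoint_yblk_xblk : Disjoint (Finset.univ.filter fun i : Hankel.In m => ¬ (i : ℕ) < m) (xblk m m) := by
  rw [Finset.disjoint_left]
  intro i hi hi'
  simp only [Finset.mem_filter, Finset.mem_univ, true_and, xblk] at hi hi'
  exact hi hi'

/-- **THE KERNEL OF THE `x`-MONOMIAL: `Kr(univ, x₀ ∧ ⋯ ∧ x_{m−1}, k) = xIdeal k`** — a degree-`k` form kills `E_{x-block}` iff every monomial in
it meets the `x`-block (every field, `m`, `k`). -/
theorem Kr_xprod (k : ℕ) : Kr K Finset.univ (xprod K m m) k = xIdeal K m k := by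
  classical
  obtain ⟨c, hc, hx⟩ := xprod_eq_smul_B K m le_rfl
  rw [hx, Kr_smul K _ hc]
  apply le_antisymm
  · intro θ hθ
    obtain ⟨hθH, hθf⟩ := mem_Kr.mp hθ
    have hθSp : θ ∈ Weil.Sp K (fun s : Finset (Hankel.In m) => s ⊆ Finset.univ ∧ s.card = k) := by rwa [← Weil.Hom_eq_Sp]
    -- split θ into its y-supported part and the part meeting the x-block
    have hsplit := Weil.proj_add_proj_not (K := K) (fun s : Finset (Hankel.In m) => ∀ i ∈ s, ¬ (i : ℕ) < m) θ
    have hnot : Weil.proj (K := K) (fun s : Finset (Hankel.In m) => ¬ ∀ i ∈ s, ¬ (i : ℕ) < m) θ ∈ xIdeal K m k := by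
      have h := Weil.proj_mem_and (P := fun s : Finset (Hankel.In m) => ¬ ∀ i ∈ s, ¬ (i : ℕ) < m) hθSp
      refine Weil.Sp_mono (fun s hs => ⟨hs.1.2, ?_⟩) h
      have h' := hs.2
      push Not at h'
      exact h'
    have hyz : Weil.proj (K := K) (fun s : Finset (Hankel.In m) => ∀ i ∈ s, ¬ (i : ℕ) < m) θ = 0 := by
      have hy : Weil.proj (K := K) (fun s : Finset (Hankel.In m) => ∀ i ∈ s, ¬ (i : ℕ) < m) θ ∈
          Alg K (Hankel.In m) (Finset.univ.filter fun i : Hankel.In m => ¬ (i : ℕ) < m) := by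
        refine Weil.Sp_mono (fun s hs => ?_) (Weil.proj_mem _ θ)
        intro i hi
        simp only [Finset.mem_filter, Finset.mem_univ, true_and]
        exact hs i hi
      refine eq_zero_of_mul_B_eq_zero K (disjoint_yblk_xblk m) hy ?_
      have h0 : (Weil.proj (K := K) (fun s : Finset (Hankel.In m) => ∀ i ∈ s, ¬ (i : ℕ) < m) θ +
          Weil.proj (K := K) (fun s : Finset (Hankel.In m) => ¬ ∀ i ∈ s, ¬ (i : ℕ) < m) θ) * B K (Hankel.In m) (xblk m m) = 0 := by
        rw [hsplit]; exact hθf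
      have hgen : ∀ z ∈ xIdeal K m k, z * B K (Hankel.In m) (xblk m m) = 0 := by
        intro z hz
        rw [xIdeal, Weil.Sp] at hz
        induction hz using Submodule.span_induction with
        | mem x hx' => obtain ⟨s, hs, rfl⟩ := hx'; exact B_mul_B_xblk_eq_zero K m hs.2
        | zero => rw [zero_mul]
        | add x y _ _ hx' hy' => rw [add_mul, hx', hy', add_zero]
        | smul a x _ hx' => rw [smul_mul_assoc, hx', smul_zero]
      have h1 := hgen _ hnot
      rwa [add_mul, h1, add_zero] at h0
    rw [← hsplit, hyz, zero_add]
    exact hnot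
  · rw [xIdeal, Weil.Sp, Submodule.span_le]
    rintro _ ⟨s, hs, rfl⟩
    exact mem_Kr.mpr ⟨B_mem_Hom K (Finset.subset_univ s) hs.1, B_mul_B_xblk_eq_zero K m hs.2⟩

/-- the IDEAL OF A FRAME in degree `k ≥ 1`: `frameIdeal v k := Σ_{a<m} (K·v_a) ∧ Hom(univ, k−1)`. -/
noncomputable def frameIdeal (v : ℕ → HT K (Hankel.In m)) (k : ℕ) : Submodule K (HT K (Hankel.In m)) :=
  ⨆ a ∈ Finset.range m, (K ∙ v a) * Hom K (Hankel.In m) Finset.univ (k - 1)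

/-- **`xIdeal k = Σ_{a<m} x_a ∧ Hom(univ, k−1)` for `k ≥ 1`**: the monomials meeting the `x`-block are the degree-`k` part of the ideal of the
`x`-generators. -/
theorem xIdeal_eq_frameIdeal {k : ℕ} (hk : 1 ≤ k) : xIdeal K m k = frameIdeal K m (Hankel.X K m) k := by
  classical
  apply le_antisymm
  · rw [xIdeal, Weil.Sp, Submodule.span_le]
    rintro _ ⟨s, ⟨hsk, i, hi, him⟩, rfl⟩
    have hsplit : B K (Hankel.In m) s = (u K {i} (s.erase i))⁻¹ • (B K (Hankel.In m) {i} * B K (Hankel.In m) (s.erase i)) := by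
      have hdis : Disjoint ({i} : Finset (Hankel.In m)) (s.erase i) :=
        Finset.disjoint_singleton_left.mpr (Finset.notMem_erase i s)
      rw [B_mul_B, smul_smul, inv_mul_cancel₀ ((u_ne_zero_iff K).mpr hdis), one_smul, ← Finset.insert_eq, Finset.insert_erase hi]
    show B K (Hankel.In m) s ∈ _
    rw [hsplit]
    refine Submodule.smul_mem _ _ (Submodule.mem_iSup_of_mem (i : ℕ) (Submodule.mem_iSup_of_mem (Finset.mem_range.mpr him)
      (Submodule.mul_mem_mul ?_ (B_mem_Hom K (Finset.subset_univ _) ?_))))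
    · rw [Hankel.X, dif_pos him, gx, show Hankel.xI (i : ℕ) him = i from Fin.ext rfl]
      exact Submodule.mem_span_singleton_self _
    · rw [Finset.card_erase_of_mem hi, hsk]
  · refine iSup₂_le fun a ha => Submodule.mul_le.mpr fun x hx y hy => ?_
    have ham : a < m := Finset.mem_range.mp ha
    obtain ⟨c, rfl⟩ := Submodule.mem_span_singleton.mp hx
    rw [smul_mul_assoc]
    refine Submodule.smul_mem _ _ ?_
    rw [Hankel.X, dif_pos ham, gx]
    induction hy using Submodule.span_induction with
    | mem z hz =>
      obtain ⟨t, ⟨-, htk⟩, rfl⟩ := hz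
      rw [B_mul_B]
      by_cases hdis : Disjoint ({Hankel.xI a ham} : Finset (Hankel.In m)) t
      · refine Submodule.smul_mem _ _ (Submodule.subset_span ⟨_, ⟨?_, Hankel.xI a ham, ?_, ham⟩, rfl⟩)
        · rw [Finset.card_union_of_disjoint hdis, Finset.card_singleton, htk]; omega
        · exact Finset.mem_union_left _ (Finset.mem_singleton_self _)
      · rw [u_eq_zero K hdis, zero_smul]; exact Submodule.zero_mem _
    | zero => rw [mul_zero]; exact Submodule.zero_mem _
    | add z w _ _ hz hw => rw [mul_add]; exact Submodule.add_mem _ hz hw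
    | smul c' z _ hz => rw [mul_smul_comm]; exact Submodule.smul_mem _ _ hz

/-! ## §5. The kernel of the pure class, named -/

/-- `Ψ` carries the ideal of the `x`-frame to the ideal of the sheared frame: `Ψ_λ (Σ_a x_a ∧ ⋀^{k−1}) = Σ_a u_a ∧ ⋀^{k−1}`. -/
theorem map_Ψ_frameIdeal_X (lam : K) (k : ℕ) :
    (frameIdeal K m (Hankel.X K m) k).map (Ψ K (shearEquiv K m lam)).toLinearMap = frameIdeal K m (uvec K m lam) k := by
  rw [frameIdeal, frameIdeal, Submodule.map_iSup]
  refine iSup_congr fun a => ?_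
  rw [Submodule.map_iSup]
  refine iSup_congr fun _ => ?_
  rw [show (Ψ K (shearEquiv K m lam)).toLinearMap = (Ψ K (shearEquiv K m lam)).toAlgHom.toLinearMap from rfl, Submodule.map_mul,
    show (Ψ K (shearEquiv K m lam)).toAlgHom.toLinearMap = (Ψ K (shearEquiv K m lam)).toLinearMap from rfl, map_Ψ_Hom_univ,
    Submodule.map_span, Set.image_singleton, AlgEquiv.toLinearMap_apply, Ψ_shear_X]

/-- **THE KERNEL OF A PURE CLASS IS THE IDEAL OF ITS FRAME: `Kr(univ, w_m(Aλ^•), k) = Σ_{a<m} (x_a + λ y_a) ∧ Hom(univ, k−1)`** for `A ≠ 0`,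
every `λ`, every `k ≥ 1` (every field, every `m`). -/
theorem Kr_w_expSeq {A : K} (hA : A ≠ 0) (lam : K) {k : ℕ} (hk : 1 ≤ k) :
    Kr K Finset.univ (Hankel.w K m m (expSeq K A lam)) k = frameIdeal K m (uvec K m lam) k := by
  rw [w_expSeq_eq_Ψ, Kr_smul K _ hA, ← map_Ψ_Kr, Kr_xprod, xIdeal_eq_frameIdeal K m hk, map_Ψ_frameIdeal_X]

/-- **every frame vector kills the pure class: `u_a ∈ Kr(univ, w_m(Aλ^•), 1)`** (`A ≠ 0`, `a < m`): pure classes are never non-degenerate. -/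
theorem uvec_mem_Kr_one {A : K} (hA : A ≠ 0) (lam : K) {a : ℕ} (ha : a < m) :
    uvec K m lam a ∈ Kr K Finset.univ (Hankel.w K m m (expSeq K A lam)) 1 := by
  rw [Kr_w_expSeq K m hA lam le_rfl]
  have h1 : uvec K m lam a * 1 ∈ (K ∙ uvec K m lam a) * Hom K (Hankel.In m) Finset.univ (1 - 1) :=
    Submodule.mul_mem_mul (Submodule.mem_span_singleton_self _)
      (by rw [Nat.sub_self, Hom_zero_eq_one]; exact Submodule.one_le.mp le_rfl)
  rw [mul_one] at h1
  exact Submodule.mem_iSup_of_mem a (Submodule.mem_iSup_of_mem (Finset.mem_range.mpr ha) h1)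

/-- **DIMENSION: `dim Kr(univ, w_m(Aλ^•), k) + C(m, k) = C(2m, k)`** (`A ≠ 0`, every `λ`, every `k`; 591's Hankel rank `1` + rank–nullity). -/
theorem finrank_Kr_w_expSeq_add {A : K} (hA : A ≠ 0) (lam : K) (k : ℕ) :
    finrank K (Kr K Finset.univ (Hankel.w K m m (expSeq K A lam)) k) + m.choose k = (m + m).choose k := by
  have h := finrank_Kr_add_finrank_V K (Finset.univ : Finset (Hankel.In m)) (Hankel.w K m m (expSeq K A lam)) k
  rw [Finset.card_univ, Fintype.card_fin, V_univ] at h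
  rw [← finrank_range_wedge_w_expSeq K m hA lam k]
  exact h

/-- hence **`dim (Σ_{a<m} u_a ∧ Hom(univ, k−1)) = C(2m, k) − C(m, k)`** (`k ≥ 1`): the degree-`k` part of the ideal of the frame. -/
theorem finrank_frameIdeal_uvec (lam : K) {k : ℕ} (hk : 1 ≤ k) :
    finrank K (frameIdeal K m (uvec K m lam) k) = (m + m).choose k - m.choose k := by
  have h := finrank_Kr_w_expSeq_add K m one_ne_zero lam k
  rw [Kr_w_expSeq K m one_ne_zero lam hk] at h
  omega

end Shear
end Summit.Ventures.HSemireg.Wedge.HankelPureKernel
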